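import Literature.Computability.Complexity.MurrayWilliams2018EasyWitness
import Literature.Computability.Complexity.MurrayWilliams2018NQPQuasi
import Literature.Computability.Complexity.SmoothQuasiPoly
import HarnessLib

/-!
# Murray–Williams 2018, Theorem 1.2 for `AC⁰[m]`: the printed proof, second layer (components)

`MurrayWilliams2018.lean` reduces Murray–Williams' Theorem 1.3 (threshold-free;
`MurrayWilliams2018_NTIME_not_depth_ACC`, `CircuitLowerBounds.lean`) to two named facts and proves
the assembly: the *algorithms-to-lower-bounds connection for `NQP`*,
`MurrayWilliams2018_thm_1_2_acc` (C. D. Murray, R. R. Williams, *Circuit lower bounds for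
nondeterministic quasi-polytime: an easy witness lemma for NP and NQP*, STOC 2018, Thm. 1.2, for
the classes `AC⁰[m]`), and the `ACC`-SAT algorithm `MurrayWilliams2018_thm_5_1` (Thm. 5.1; reduced
to Williams' Thm. 4.1 in `Williams2014AccSat.lean`). This file DECOMPOSES the connection one level
further, into the results its printed proof quotes (§5, proof of Thm. 1.1 and its modification
for Thm. 1.2), over the notions of `MurrayWilliams2018EasyWitness.lean` (witness circuits
`HasWitnessCircuits`/`NTIMEHasWitnessCircuits`, unary languages `IsUnaryLanguage`, the general
easy witness lemma `MurrayWilliams2018_lemma_4_1_ae`): it fixes the readings of the two printed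
components and proves the elementary links the assembly consumes. The assembly itself —
`MurrayWilliams2018_thm_1_2_acc` from the two components — is the theorem
`MurrayWilliams2018_thm_1_2_acc_of_EWL_of_simulation` of `MurrayWilliams2018Hierarchy.lean`, with
the hierarchy step supplied by the tree's PROVED nondeterministic time hierarchy theorem
(`Diag.ntime_hierarchy_holds`, `DiagMachine.lean`). The components:

* the **easy witness lemma for `NQP`** (Lemma 1.3: if `NQP` has `2^{log^k n}`-size circuits
  then `NQP` has witness circuits of size `2^{O(log^{k³} n)}`; the case `s(n) = 2^{log^k n}` of
  Lemma 4.1) read at the tree's levels `NTIME (n ^ (log₂ n) ^ e)` — hypothesis `hEWL` of the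
  assembly, in the minimal shape the proof consumes (witness size `2^{(log₂ n)^K}` for SOME `K`);
* the **nondeterministic simulation `N` of §5** (proof of Thm. 1.1, steps 1–4 and the
  `EVAL-GATE`/consistency-circuit argument, as modified for Thm. 1.2) — hypothesis `hN` of the
  assembly: a (unary, in the source; arbitrary, in `MurrayWilliams2018Hierarchy.lean`)
  `L ∈ NTIME[g]` with `2^{log^K n}`-size witness circuits at a level above
  `g · poly` is in `NTIME[f]` for every `f` a factor `2^{(log g)^{1/r}}/polylog g` below `g`,
  provided `P` has depth-`d` `AC⁰[m]` circuits of size `2^{log^k n}` and depth-`(d + c₀)`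
  `AC⁰[m]`-SAT of `2^{n^{1/r}}`-size circuits runs in time `2^{n - n^{1/r}}` (`AccSatSubexp`,
  `MurrayWilliams2018.lean`); it bundles the PCP of Ben-Sasson–Viola (ICALP 2014) used there, for
  which the tree has no notion yet;
* **proved here**: the elementary links of §5 — (i) small `AC⁰[m]` circuit families are small
  unrestricted circuits almost everywhere (`ACC` circuits are evaluatable:
  `mem_SIZE_of_mem_depthSizeClass_accBasis`, `MurrayWilliams2018NQPQuasi.lean`;
  `eventually_circuitSize_le_of_mem_depthSizeClass`), (iii) `P ⊆ NTIME[n^{log n}]`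
  (`P_subset_NTIME_pow_log`, from `DTIME_subset_NTIME_of_dominated`), the monotonicity of the
  levels and size bounds (`pow_log_pow_exp_mono`, `mul_two_pow_log_pow_le_succ`), and the growth
  estimate `smoothQP E (n + 1) = O(smoothQP E n)` (`isBigO_smoothQP_succ`) of the smooth
  quasi-polynomial level of `SmoothQuasiPoly.lean`. The assembly
  (`MurrayWilliams2018_thm_1_2_acc_of_EWL_of_simulation`, `MurrayWilliams2018Hierarchy.lean`)
  follows §5: assuming every level `NTIME[n^{log^e n}]` has depth-`d`, `2^{log^k n}`-size
  `AC⁰[m]` circuits, (i) gives `2^{log^{k+2} n}`-size unrestricted circuits a.e., (ii) hence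
  witness circuits of size `2^{log^K n}` at all high levels (Lemma 1.3), (iii) `P` has the
  assumed `AC⁰[m]` circuits, (iv) the hierarchy theorem gives `L ∈ NTIME[g]` outside `NTIME[f]`
  for `g = smoothQP E ≈ 2^{log^{E+1} n}` and `f = smoothQPSim E = g / 2^{log² n}` (`g`, `f` time
  constructible, `f(n + 1) = o(g(n))`), (v) the simulation puts `L ∈ NTIME[f]` — contradiction.

The two components are stated as HYPOTHESES of the assembly and not vendored as named facts
(a proving unit may not enlarge the stock of unproved named facts, D-0026): `hEWL` is DERIVED from
`MurrayWilliams2018_lemma_4_1_ae` in `MurrayWilliams2018Lemma13.lean`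
(`MurrayWilliams2018_lemma_1_3_of_lemma_4_1_ae`), and a unit discharging the simulation closes
`MurrayWilliams2018_thm_1_2_acc` by one application of the assembly theorem.

## Faithfulness notes

* Lemma 1.3 is printed as "There is a `c ≥ 1` such that for all `k ≥ 1`, if
  `NQP ⊂ SIZE[2^{log^k n}]` then every `L ∈ NQP` has witness circuits of size `2^{c log^{k³} n}`",
  and is the case `s(n) = 2^{(log n)^k}` of Lemma 4.1 (p. 11: "For `s(n) = 2^{(log n)^k}`,
  `NQP ⊂ SIZE[2^{(log n)^k}]` implies that `NQP` has witness circuits of size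
  `2^{O((log n)^{k³})}` (Theorem 1.3)"), vendored in general form as
  `MurrayWilliams2018_lemma_4_1`/`MurrayWilliams2018_lemma_4_1_ae` (`MurrayWilliams2018EasyWitness.lean`).
  The hypothesis `hEWL` renders Lemma 1.3 with: the levels of `NQP` in the form
  `NTIME (n ^ (log₂ n) ^ e)`, `e ≥ 1`,
  of Thm. 1.3 (`2^{log^{e+1} n} = n^{log^e n}` under the source's convention "all logarithms are
  base-2 with ceilings as appropriate", §2); the hypothesis `NQP ⊂ SIZE[2^{log^k n}]` in the
  almost-everywhere form `∀ᶠ n, L.circuitSize n ≤ 2^{(log₂ n)^k}` for the languages of every level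
  (the reading of `SIZE` of `MurrayWilliams2018_lemma_4_1_ae` and of IKW in `EasyWitness.lean`:
  the printed proof uses the assumed circuits only at large lengths); the conclusion
  `NTIMEHasWitnessCircuits` (every language of the level, every correct verifier, all long inputs)
  of size `2^{(log₂ n)^K}` for SOME `K` depending on `k` (the printed `2^{c log^{k³} n} ≤
  2^{log^{ck³} n}` once `log n ≥ 2`; only the existence of `K` is used) for all levels `e ≥ e₀`,
  `e₀` depending on `k` — condition (b) of Lemma 4.1, `t(n) ≥ s₂(s₂(s₂(n)))^d = 2^{O(log^{k³} n)}`.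
  Deriving `hEWL` from `MurrayWilliams2018_lemma_4_1_ae` inside the tree (apply it with a strictly
  increasing time-constructible `s ≥ 2^{(log₂ n)^k}` and `t = n ^ (log₂ n) ^ e`) needs, besides the
  arithmetic of `stretch^[3]`, the time constructibility of the step levels and the inclusion
  `NTIME ((n ^ (log₂ n) ^ e) ^ e') ⊆ NTIME (n ^ (log₂ n) ^ (e + 1))` in the tree's one-constant
  verifier form of `NTIME` — a clock construction like `QuasiPolyClock.lean` (an eventual form of
  the named fact `NTIME_mono` of `Nondeterministic.lean`: the pointwise form cannot reach a step
  level from the `e'`-th power of a time-constructible bound, `e' ≥ 2`, at `n = 2`).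
* The hierarchy theorem. P. 14: "Take `L ∈ NTIME[t(n)] - NTIME[t(n)/2^{log^{ε/2} t(n)}]` such
  that `L ⊆ {1ⁿ | n ≥ 0}` [SFM78, Žák83]". The tree supplies the hard language by its proved
  hierarchy theorem `Diag.ntime_hierarchy_holds` (time-constructible `f`, `g` with
  `f(n + 1) = o(g(n))` give `NTIME g ⊄ NTIME f`; the hard language is binary) at `g = smoothQP E`,
  `f = smoothQPSim E` (`exists_mem_NTIME_smoothQP_not_mem_smoothQPSim`,
  `MurrayWilliams2018Hierarchy.lean`). The unary clause is not needed: no step of the simulation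
  `N` reads the letters of its input, and the source itself runs the argument on a non-unary `L`
  in its Remark 1 (see the faithfulness notes of `MurrayWilliams2018Hierarchy.lean`); Žák's
  hierarchy theorem with one-letter witness languages (Žák 1983, Thm. 2.2 — a second
  diagonalizer, over unary inputs) is therefore not vendored. With the tree's integer logarithm
  the literal level `2^{(log₂ n)^a}` is a step function jumping by a quasi-polynomial factor at
  powers of two, for which `t'(n + 1) = o(t(n))` fails for `t'` within such a factor; the
  source's real-valued `2^{log^a n}` has no jumps, and `SmoothQuasiPoly.lean` supplies the
  integer-valued smooth level `smoothQP E` (`≈ 2^{(log₂ n)^{E+1}}`, sandwiched between the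
  tree's levels) fed to the hierarchy theorem (`isLittleO_smoothQPSim_succ`; also
  `smoothQP E (n + 1) = O(smoothQP E n)`, `isBigO_smoothQP_succ` below).
* The simulation. §5 proves Thm. 1.1/1.2 for a *typical* class `C` with a NONDETERMINISTIC
  `GAP C UNSAT` algorithm, whence the PCP of Ben-Sasson–Viola (soundness gap) and the case
  analysis "`D(x) = 0` on at least `3/4` of the inputs". `MurrayWilliams2018_thm_1_2_acc` assumes
  a DETERMINISTIC exact `AC⁰[m]`-SAT algorithm (`AccSatSubexp`, the form Thm. 5.1 provides), for
  which the printed algorithm `N` simplifies (exact answers on `D` and on `E(C_n^O, W_n, ·, s)`),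
  and we vendor `N` in that setting: hypotheses (1) `AccSatSubexp (d + c₀) m r` for an absolute
  depth overhead `c₀` (the circuit `D` of §5 is an `OR` of `3`-CNF consistency checks over copies
  of the guessed depth-`d` circuit `E`: "since `C` is closed under conjunctions and projections,
  given `E`, `C_n^O`, and `W_n`, the circuit `D` can be computed … where `D` is a circuit from
  `C`"); (2) `P` has depth-`d` `AC⁰[m]` circuits of size `2^{log^k n}` ("Clearly EVAL-GATE is
  computable in polynomial time. By assumption (A), EVAL-GATE has `C`-circuits"); (3) the level
  `g` is polynomial-time computable from `1ⁿ` (the source's `t(n) = 2^{log^a n}`; needed to lay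
  out the PCP circuit `C_n^O` with `ℓ = log₂ T + O(log log T)` inputs in `poly(n)` time, p. 14:
  "an algorithm `A` running in `poly(n, log T(n))` time which, given `x`, outputs an oracle
  circuit `C_x^O`") and `log₂ g(n) ≫ (log₂ n)^{kKr}` ("for sufficiently large `c`, the size of `D`
  is `2^{O(log^{k⁴} n)} ≤ 2^{ℓ^ε}`"); (4) `L` unary in `NTIME[g]` ("On an input `1ⁿ`, let `N` …");
  (5) witness circuits of size `2^{(log₂ n)^K}` for the verifiers of `L` at a level `T` above
  `g · poly(n)` (step 2 of `N`: "guesses a witness circuit `W_n` of size `2^{O(log^{k³} n)}`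
  encoding the oracle `O` for the PCP verifier" — the PCP verifier checks the `2^ℓ = T · polylog T`
  constraints of `C_n^O`, a `g · poly(n)`-time verifier, which in the tree's one-constant
  verifier form is a verifier at every level `T` with `g(n) (n + 2)^b ≤ a T(n) + a`; the
  eventual form of `HasWitnessCircuits` suffices, the finitely many short inputs of a unary
  language being decided by table lookup); conclusion `L ∈ NTIME[f]` for every `f ≥ n` with
  `g (log₂ g)^b ≤ f · 2^{⌊(log₂ g)^{1/r}⌋}` eventually ("obtaining yes/no answers in
  nondeterministic time `O(2^{ℓ - ℓ^ε}) ≤ t(n)/2^{log^ε t(n)}`"; `polylog` from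
  `2^ℓ = T · polylog T`). The exponent `b` is quantified after `g` (it covers the degree of the
  polynomial-time machine computing `g`, through which `log₂ g ≤ poly(n)`). Every hypothesis is
  implied by the corresponding printed step and the conclusion is the printed running time of
  `N`; the statement (hypothesis `hN`) is bespoke to this decomposition in the same way as
  `Williams2014_thm_3_2` (`Williams2014Transfer.lean`).
* Sizes: `DepthSizeClass` bounds gates (`Circuit.size`), the source unrestricted circuits by
  fan-in-two gates; `s` gates over `accBasis m` on `n` inputs become
  `≤ 1 + s((4m+1)(n+s) + m + 2)` gates over `B₂` (`mem_SIZE_of_mem_depthSizeClass_accBasis`;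
  "`C` is evaluatable", §2).

## References

* C. D. Murray, R. R. Williams, *Circuit lower bounds for nondeterministic quasi-polytime: an
  easy witness lemma for NP and NQP*, STOC 2018, 890–901 (ECCC TR17-188; SIAM J. Comput. 49
  (2020)), §2 (witness circuits, typical classes), Lemma 1.3, Lemma 4.1, §5 (proofs of
  Thms. 1.1, 1.2) [MurrayWilliams2018].
* S. Žák, *A Turing machine time hierarchy*, Theoret. Comput. Sci. 26 (1983) 327–333, Thm. 2.2
  [Zak1983].
* S. Arora, B. Barak, *Computational Complexity: A Modern Approach*, CUP 2009, Claim 2.4, §6.1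
  [AroraBarak2009].
* E. Ben-Sasson, E. Viola, *Short PCPs with projection queries*, ICALP 2014, 163–173.
* R. Williams, *Nonuniform ACC circuit lower bounds*, J. ACM 61 (2014), §5 (witness circuits)
  [Williams2014].
-/

noncomputable section

namespace Literature.Computability.Complexity

open _root_.Computability Turing Filter Asymptotics Classes

/-! ### Proved: elementary links -/

/-- Witness circuits for a whole level are witness circuits for every language having a verifier
of that level (`L ∈ NTIME t ↔ Nonempty (NVerifier t L)`), with no membership side condition.
[folklore] -/
theorem NTIMEHasWitnessCircuits.hasWitnessCircuits {t w : ℕ → ℕ} (h : NTIMEHasWitnessCircuits t w)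
    (L : Language Bool) : HasWitnessCircuits t L w :=
  fun V => h L (mem_NTIME_iff_nonempty_nVerifier.2 ⟨V⟩) V

/-- The levels `n ^ (log₂ n) ^ e` are monotone in the exponent `e` (at every `n`, including
`n ≤ 1`). [folklore] -/
theorem pow_log_pow_exp_mono {e e' : ℕ} (h : e ≤ e') (n : ℕ) :
    n ^ Nat.log 2 n ^ e ≤ n ^ Nat.log 2 n ^ e' := by
  rcases Nat.eq_zero_or_pos n with rfl | hn
  · rcases Nat.eq_zero_or_pos e with rfl | he
    · simp
    · have he' : e' ≠ 0 := by omega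
      simp [Nat.log_zero_right, zero_pow he.ne', zero_pow he']
  · rcases Nat.eq_zero_or_pos (Nat.log 2 n) with hl | hl
    · have h1 : n = 1 := by
        have := Nat.lt_pow_succ_log_self one_lt_two n
        rw [hl] at this
        omega
      subst h1
      simp
    · exact Nat.pow_le_pow_right hn (Nat.pow_le_pow_right hl h)

/-- `c · 2 ^ (log₂ n) ^ k + c ≤ 2c · 2 ^ (log₂ n) ^ (k + 1) + 2c` (the `O`-form size bound at
exponent `k` is dominated by the one at `k + 1`, at every length). [folklore] -/
theorem mul_two_pow_log_pow_le_succ (c k n : ℕ) :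
    c * 2 ^ Nat.log 2 n ^ k + c ≤ 2 * c * 2 ^ Nat.log 2 n ^ (k + 1) + 2 * c := by
  have h : Nat.log 2 n ^ k ≤ Nat.log 2 n ^ (k + 1) + 1 := by
    rcases Nat.eq_zero_or_pos (Nat.log 2 n) with hl | hl
    · rw [hl]; rcases Nat.eq_zero_or_pos k with rfl | hk <;> simp [*, Nat.pos_iff_ne_zero.mp]
    · exact (Nat.pow_le_pow_right hl (Nat.le_succ k)).trans (Nat.le_succ _)
  have h2 : 2 ^ Nat.log 2 n ^ k ≤ 2 * 2 ^ Nat.log 2 n ^ (k + 1) := by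
    calc 2 ^ Nat.log 2 n ^ k ≤ 2 ^ (Nat.log 2 n ^ (k + 1) + 1) := Nat.pow_le_pow_right two_pos h
      _ = 2 * 2 ^ Nat.log 2 n ^ (k + 1) := by rw [pow_succ, mul_comm]
  nlinarith

/-- `nᵈ ≤ n ^ log₂ n + 2^{d·d}` (for `n ≥ 2ᵈ` the exponent `log₂ n` dominates `d`; the smaller `n`
contribute at most `(2ᵈ)ᵈ`). [folklore] -/
theorem pow_le_pow_log_add (d n : ℕ) : n ^ d ≤ n ^ Nat.log 2 n + 2 ^ (d * d) := by
  rcases lt_or_ge n (2 ^ d) with hn | hn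
  · calc n ^ d ≤ (2 ^ d) ^ d := Nat.pow_le_pow_left hn.le d
      _ = 2 ^ (d * d) := by rw [← pow_mul]
      _ ≤ n ^ Nat.log 2 n + 2 ^ (d * d) := Nat.le_add_left _ _
  · have hn0 : 0 < n := lt_of_lt_of_le (Nat.two_pow_pos d) hn
    have hd : d ≤ Nat.log 2 n := (Nat.le_log_iff_pow_le one_lt_two hn0.ne').mpr hn
    exact (Nat.pow_le_pow_right hn0 hd).trans (Nat.le_add_right _ _)

/-- **`P ⊆ NTIME[n^{log n}]`** (the level `e = 1`; Arora–Barak 2009, Claim 2.4: deterministic time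
is nondeterministic time, via the tree's `DTIME_subset_NTIME_of_dominated`, every polynomial being
`≤ b · n ^ log₂ n + b`). Murray–Williams 2018, §5: "Clearly EVAL-GATE is computable in polynomial
time. By assumption (A), EVAL-GATE has `C`-circuits". [cite: AroraBarak2009, Claim 2.4] -/
theorem P_subset_NTIME_pow_log : Classes.P ⊆ NTIME (fun n => n ^ Nat.log 2 n ^ 1) := by
  intro L hL
  simp only [Classes.P, Set.mem_iUnion] at hL
  obtain ⟨j, hj⟩ := hL
  refine DTIME_subset_NTIME_of_dominated (fun a p => ?_) hj
  obtain ⟨c₁, d₁, h₁⟩ := exists_eval_le_mul_pow_add p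
  refine ⟨c₁ + a + (c₁ * 2 ^ (d₁ * d₁) + c₁ + a * 2 ^ (j * j) + a), fun n => ?_⟩
  have e1 := pow_le_pow_log_add d₁ n
  have e2 := pow_le_pow_log_add j n
  simp only [pow_one]
  calc p.eval n + (a * n ^ j + a) ≤ c₁ * n ^ d₁ + c₁ + (a * n ^ j + a) := by gcongr; exact h₁ n
    _ ≤ c₁ * (n ^ Nat.log 2 n + 2 ^ (d₁ * d₁)) + c₁ + (a * (n ^ Nat.log 2 n + 2 ^ (j * j)) + a) := by
        gcongr
    _ = (c₁ + a) * n ^ Nat.log 2 n + (c₁ * 2 ^ (d₁ * d₁) + c₁ + a * 2 ^ (j * j) + a) := by ring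
    _ ≤ _ := Nat.add_le_add (Nat.mul_le_mul_right _ (Nat.le_add_right _ _)) (Nat.le_add_left _ _)

/-- **`smoothQP E (n + 1) = O(smoothQP E n)`** — Žák's growth hypothesis `t(n + 1) = O(t(n))` for
the smooth quasi-polynomial level: eventually `qpExp E (n + 1) ≤ qpExp E n + 2`
(`eventually_qpExp_succ_le`, `SmoothQuasiPoly.lean`), so `g(n + 1) ≤ 4 g(n)`.
[cite: Zak1983, Thm. 2.2] -/
theorem isBigO_smoothQP_succ (E : ℕ) :
    (fun n => (smoothQP E (n + 1) : ℝ)) =O[atTop] fun n => (smoothQP E n : ℝ) := by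
  refine IsBigO.of_bound 4 ((eventually_qpExp_succ_le E).mono fun n hn => ?_)
  rw [Real.norm_natCast, Real.norm_natCast]
  have h : smoothQP E (n + 1) ≤ 4 * smoothQP E n := by
    calc smoothQP E (n + 1) = 2 ^ qpExp E (n + 1) := rfl
      _ ≤ 2 ^ (qpExp E n + 2) := Nat.pow_le_pow_right two_pos hn
      _ = 4 * smoothQP E n := by rw [pow_add, smoothQP]; ring
  exact_mod_cast h

/-! ### Proved: `ACC` circuits are unrestricted circuits (the `SIZE` hypothesis of Lemma 1.3) -/

/-- The exponent inequality: for `L ≥ A + 4`, `A + 2 Lᵏ + L + 1 ≤ L^{k+2}`. [folklore] -/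
theorem circuitSize_exponent_le {A k L : ℕ} (hL : A + 4 ≤ L) : A + 2 * L ^ k + L + 1 ≤ L ^ (k + 2) := by
  have hL1 : 1 ≤ L := by omega
  have hLk : 1 ≤ L ^ k := Nat.one_le_pow _ _ hL1
  set P := L ^ k * L with hP
  have hP1 : 1 ≤ P := le_trans hLk (Nat.le_mul_of_pos_right _ hL1)
  have hPk : L ^ k ≤ P := Nat.le_mul_of_pos_right _ hL1
  have hPL : L ≤ P := Nat.le_mul_of_pos_left _ hLk
  have h1 : A + 2 * L ^ k + L + 1 ≤ (A + 4) * P := by nlinarith [Nat.mul_le_mul_left A hP1]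
  calc A + 2 * L ^ k + L + 1 ≤ (A + 4) * P := h1
    _ ≤ L * P := Nat.mul_le_mul_right _ hL
    _ = L ^ (k + 2) := by rw [hP]; ring

/-- **Small `AC⁰[m]` circuit families give small unrestricted circuits, almost everywhere**: if
`L` has depth-`d` `AC⁰[m]` circuits (`m ≥ 2`) of size `c · 2^{(log₂ n)^k} + c`, then eventually
`L.circuitSize n ≤ 2^{(log₂ n)^{k+2}}` (`mem_SIZE_of_mem_depthSizeClass_accBasis`: `S n` gates over
`accBasis m` on `n` inputs become `≤ 1 + S n · ((4m+1)(n + S n) + m + 2)` gates over `B₂`, a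
polynomial in `n · 2^{(log₂ n)^k}`; Murray–Williams 2018, §5: "Since `C` is evaluatable …, from (A)
it follows that `NTIME[t(n)]` has … unrestricted circuits"). [cite: MurrayWilliams2018, §5 (proof of Thm. 1.1)] -/
theorem eventually_circuitSize_le_of_mem_depthSizeClass {m d c k : ℕ} (hm : 2 ≤ m)
    {L : Language Bool}
    (hL : L ∈ DepthSizeClass (accBasis m) (fun _ => d) (fun n => c * 2 ^ Nat.log 2 n ^ k + c)) :
    ∀ᶠ n in atTop, L.circuitSize n ≤ 2 ^ Nat.log 2 n ^ (k + 2) := by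
  have hSIZE := mem_SIZE_of_mem_depthSizeClass_accBasis (by omega : 0 < m) hL
  have hcs := (mem_SIZE_iff_circuitSize_le_holds L _).1 hSIZE
  -- constants
  set B : ℕ := (4 * m + 1) * (1 + 2 * c) + (m + 2) with hB
  set A : ℕ := 1 + 2 * c * B with hA
  -- pointwise bound `circuitSize ≤ A · X² · Y`, `X = 2^{Lᵏ}`, `Y = 2^{L+1}`
  have hpt : ∀ n : ℕ, L.circuitSize n ≤
      A * (2 ^ Nat.log 2 n ^ k * 2 ^ Nat.log 2 n ^ k * 2 ^ (Nat.log 2 n + 1)) := by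
    intro n
    refine (hcs n).trans ?_
    set X : ℕ := 2 ^ Nat.log 2 n ^ k with hX
    set Y : ℕ := 2 ^ (Nat.log 2 n + 1) with hY
    set s : ℕ := c * X + c with hs
    have hX1 : 1 ≤ X := Nat.one_le_two_pow
    have hY1 : 1 ≤ Y := Nat.one_le_two_pow
    have hnY : n ≤ Y := (Nat.lt_pow_succ_log_self one_lt_two n).le
    have hsX : s ≤ 2 * c * X := by rw [hs]; nlinarith
    have hnS : n + s ≤ (1 + 2 * c) * (X * Y) := by nlinarith
    have hcost : accGateCost m (n + s) ≤ B * (X * Y) := by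
      unfold accGateCost
      have hXY : 1 ≤ X * Y := Nat.one_le_iff_ne_zero.2 (Nat.mul_ne_zero (by omega) (by omega))
      calc (4 * m + 1) * (n + s) + m + 2
          ≤ (4 * m + 1) * ((1 + 2 * c) * (X * Y)) + (m + 2) * (X * Y) := by nlinarith
        _ = B * (X * Y) := by rw [hB]; ring
    show 1 + s * accGateCost m (n + s) ≤ A * (X * X * Y)
    calc 1 + s * accGateCost m (n + s) ≤ 1 + (2 * c * X) * (B * (X * Y)) := by gcongr
      _ ≤ A * (X * X * Y) := by
          rw [hA]
          have hXXY : 1 ≤ X * X * Y :=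
            Nat.one_le_iff_ne_zero.2 (Nat.mul_ne_zero (Nat.mul_ne_zero (by omega) (by omega)) (by omega))
          nlinarith
  -- eventually `A X² Y ≤ 2^{L^{k+2}}`
  refine (eventually_ge_atTop (2 ^ (A + 4))).mono fun n hn => (hpt n).trans ?_
  set Lg := Nat.log 2 n with hLg
  have hL : A + 4 ≤ Lg := (Nat.le_log_iff_pow_le one_lt_two (by
    have := Nat.two_pow_pos (A + 4); omega)).mpr hn
  have hA2 : A ≤ 2 ^ A := Nat.lt_two_pow_self.le
  calc A * (2 ^ Lg ^ k * 2 ^ Lg ^ k * 2 ^ (Lg + 1))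
      ≤ 2 ^ A * (2 ^ Lg ^ k * 2 ^ Lg ^ k * 2 ^ (Lg + 1)) := Nat.mul_le_mul_right _ hA2
    _ = 2 ^ (A + 2 * Lg ^ k + Lg + 1) := by rw [← pow_add, ← pow_add, ← pow_add]; ring_nf
    _ ≤ 2 ^ Lg ^ (k + 2) := Nat.pow_le_pow_right two_pos (circuitSize_exponent_le hL)

end Literature.Computability.Complexity

end
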